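import Literature.NumberTheory.EllipticCurves.GreenbergVatsal2000.MultiplicativeReduction
import Literature.NumberTheory.EllipticCurves.Greenberg1999.MuInvariantParity
import HarnessLib

/-!
# Greenberg–Vatsal 2000 at a MULTIPLICATIVE Eisenstein prime: the `λ`-comparison and `μ^anal = 0`
# ISOLATED — exactly the part of the cell's flag `GV00-mult-asserted` that has no numbered anchor

HONEST FRAMING (BSD rank-`≤ 1` residual cell `b2b-bsdres`, home
`run/shared/lean/b2b/bsd-rank1-residual/`, unit `b2b-bsdres-eisenstein-p2`, gen 2): the cell deletes
the COMBINATION-SHAPED residual classes of the rank-`≤ 1` BSD formula from PUBLISHED theorems only and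
TYPES the construction-shaped ones; this is not "finishing BSD". Sub-cell X2a (`r = 0`, `p ≠ 2`,
`p ‖ N`, `E[p]` reducible WITH the Greenberg–Vatsal parity) is closed in the kernel
(`Summits/…/X2/RankZero.lean`, `targetA_of_published`) from the named fact
`lambdaMu_multiplicative_of_gvPar` (`MultiplicativeReduction.lean`, p199693), which transcribes FIVE
claims of Greenberg–Vatsal's text at a multiplicative prime: (i) `X(E/ℚ_∞)` torsion, (ii)
`char X = (f_E)` with `μ(f_E) = 0`, (iii) `L_p(E) ∈ Λ`, (iv) `μ(L_p(E)) = 0`, (v)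
`λ(L_p(E)) = λ(f_E) + e` (`e = 1` split, `0` non-split). Three of them have NUMBERED published
anchors already in the tree: (i) and (iii) are Wuthrich, Doc. Math. 19 (2014) Thm. 16 / Cor. 18 at a
semistable `p > 2` with `E[p]` reducible (`Wuthrich2014.thm16_charIdeal_dvd_multiplicative_of_reducible`,
whose conclusion `ϖ·L = ι(T^e·g)`, `g ∈ char X`, CONTAINS integrality), and (i)–(ii) are Greenberg,
LNM 1716 (1999) Prop. 5.10, printed for "good, ordinary or multiplicative reduction at `p`"
(`Greenberg1999.prop510_isTorsion_hasUnitContent_of_gvPar`). This file ISOLATES the remainder,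
(iv)+(v), as ONE named fact `lambda_muAnal_multiplicative_of_gvPar` (a `def … : Prop`, nothing
asserted) and PROVES that the three facts together are EQUIVALENT to the monolithic one
(`lambdaMu_multiplicative_of_gvPar_iff_parts`). Consequence for the referee's ruling on the flag
`GV00-mult-asserted`: the flag's load-bearing content is exactly this file's def — Greenberg–Vatsal's
display (16) (§2 pp. 28–30, the reducible computation `λ^alg_{E,Σ₀} = λ_{φ,Σ₀} + λ_{ψ,Σ₀}`, printed
under "Assume also that `E` has good ordinary reduction at `p`", every input of which — `S_A`
cotorsion, `Φ = C[p]`, `I_p` trivial on `D`, `H⁰(ℚ, E[p]) = 0` — holds verbatim for the Tate curve)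
together with Thm. (3.11) (the Eisenstein congruence, whose proof prints the `p ∣ M` paragraph),
Ferrero–Washington and Mazur–Wiles ((26)–(28): `μ(L(G)) = 0`, `λ(L(G)) = λ_{φ,Σ₀} + λ_{ψ,Σ₀}`),
Thm. (1.5) (= Cor. (2.3) + Prop. (2.4): the same Euler factors `P_ℓ`, `ℓ ∈ Σ₀`, on both sides) and
the authors' "trivial zero included" identification `char S_{E[p^∞]}(ℚ_∞)^∨ = T^e · char X(E/ℚ_∞)`
(pp. 14–15; Greenberg LNM 1716 §3, PDF p. 91; = Skinner 2016 §3.2's `Ch_L(f) = Ch_L(f)'·(γ − 1)`).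
Everything else the X2a closure uses is a numbered published theorem. Cell audit, lemma by lemma:
HOME/b2b-bsdres-eisenstein-p2/X2-GAP.md §2–§2.1.

## Citation header (read by the cell: arXiv:math/9906215 = held text `paper:arxiv-math_9906215`;
## Invent. Math. 142 (2000) 17–63; journal version not held — want acq-08463)

* p. 1: "the theorems proven in the text apply to modular forms, as well as to elliptic curves with
  multiplicative reduction at `p`. We will not attempt to state the most general versions here."
* p. 3 (results A–C on `μ^alg`): "Also, the above results are valid if `E` has multiplicative
  reduction at `p`."
* pp. 14–15: "we will treat the case where `E` has multiplicative reduction at `p`. If `E` has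
  nonsplit multiplicative reduction at `p`, then the arguments described in the introduction go
  through almost unchanged. However, if `E` has split multiplicative at `p` … `S_{E[p^∞]}(ℚ_∞)` is
  actually bigger. This corresponds to the fact that the associated `p`-adic `L`-function has a
  trivial zero. It is only when the trivial zero is included that our approach proceeds smoothly.
  On the analytic side, the case of multiplicative reduction does not introduce any serious problems."
* §2 display (16) (p. 30): `λ^alg_{E,Σ₀} = λ_{φ,Σ₀} + λ_{ψ,Σ₀}`, `μ^alg_E = 0` (from Props. (2.1),
  (2.3), (2.4), (2.5), (2.8), printed for a general ordinary `p`-adic representation; Remark (2.10):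
  "levels not divisible by `p²` and which are ordinary at `p`").
* §3 p. 32 standing assumption "either good ordinary or multiplicative reduction at `p`"; Thm. (3.11)
  "`L_{Σ₀}(E/ℚ,χ,T) ≡ u·L(G,χ,T) (mod π)`", proof: "If `(p, M) ≠ 1`, then `M` must be divisible by
  precisely the first power of `p`. In this case one can argue as follows …"; (26)–(28) and the
  deduction `μ^anal = 0`, `λ^anal_{E,Σ₀} = λ_{φ,Σ₀} + λ_{ψ,Σ₀}`; Thm. (1.5) (p. 9; proof p. 26).
* p. 20 (arXiv p. 4): "the equality `λ^alg_E = λ^anal_E` implies that `f^alg_E(T)` and `f^anal_E(T)`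
  differ by multiplication by a power of `p`. The further equality `μ^alg_E = μ^anal_E` then implies"
  equality — the deduction the tree performs in `isUnit_of_mul_eq_of_order_map_eq`.

## Contents

* `lambda_muAnal_multiplicative_of_gvPar` — the named fact: claims (iv)+(v) only.
* `lambdaMu_multiplicative_of_gvPar_of_parts` — Wuthrich Thm. 16 + Greenberg Prop. 5.10 + this fact
  ⇒ the monolithic fact; `lambda_muAnal_of_lambdaMu_multiplicative` — the converse projection;
  `lambdaMu_multiplicative_of_gvPar_iff_parts` — the equivalence (granted the two numbered facts).

References: [GreenbergVatsal2000] pp. 1, 3, 14–15, 20; §2 (16), Props. (2.1)–(2.8), Thm. (1.5); §3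
Thm. (3.11), (26)–(28). [GreenbergLNM1716] Prop. 5.10 (PDF p. 147), §3 (PDF p. 91). [Wuthrich2014]
Thm. 16 (p. 397), Cor. 18 (p. 398). [Skinner2016PacificMC] §3.2.
-/

set_option autoImplicit false

noncomputable section

open scoped Classical MatrixGroups ModularForm

open CongruenceSubgroup WeierstrassCurve Literature.NumberTheory.EllipticCurves
  Literature.NumberTheory.EllipticCurves.ModularForms
  Literature.NumberTheory.EllipticCurves.Rank1Residual

namespace Literature.NumberTheory.EllipticCurves.GreenbergVatsal2000

/-! ### The named fact: `μ^anal = 0` and the `λ`-comparison at a multiplicative Eisenstein prime -/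

/-- **Greenberg–Vatsal 2000 at a prime of MULTIPLICATIVE reduction under (GV), the `λ`/`μ^anal`
clauses only: `μ(L_p(E)) = 0` and `λ(L_p(E)) = λ(char X(E/ℚ_∞)) + e` (`e = 1` split, `0` non-split:
the trivial zero).** Invent. Math. 142 (2000) = arXiv:math/9906215: §2 display (16)
(`λ^alg_{E,Σ₀} = λ_{φ,Σ₀} + λ_{ψ,Σ₀}`, `μ^alg_E = 0`; printed under "good ordinary reduction at `p`",
asserted for multiplicative `p` on pp. 1, 3, 14–15 and formal from Props. (2.1)–(2.8), which are
printed for general ordinary representations), §3 Thm. (3.11) with its `p ∣ M` paragraph,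
Ferrero–Washington and Mazur–Wiles for (26)–(28) (`μ(L(G)) = 0`, `λ(L(G)) = λ_{φ,Σ₀} + λ_{ψ,Σ₀}`),
Thm. (1.5) (same Euler factors on both sides) and pp. 14–15 ("trivial zero included":
`char S_{E[p^∞]}(ℚ_∞)^∨ = T^e · char X(E/ℚ_∞)`). Transcription, in the vocabulary of
`lambdaMu_multiplicative_of_gvPar`: for `W/ℚ` globally minimal, `p ≠ 2` multiplicative, `GVPar W p`,
cyclotomic data `(κ, γ)`, the newform `f`, a dual datum `D` of `Sel_{p^∞}(E/ℚ_∞)`, `ϖ·Ω_E = Ω⁺_f`,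
ANY generator `fE` of `char_Λ X` and ANY `b ∈ Λ` with `ι b = ϖ·L` (`L` THE multiplicative MTT
function): `b` has unit content and `ord_T(b mod p) = ord_T(T^e·fE mod p)`. Torsion, `μ(fE) = 0` and
the existence of `b` are NOT part of this fact (Greenberg 1999 Prop. 5.10; Wuthrich 2014 Thm. 16).
Named fact; nothing asserted; no numbered theorem of the source states this case (cell flag
`GV00-mult-asserted` — this def is its exact content). [cite: GreenbergVatsal2000, §2 (16) with pp. 1, 3, 14–15; §3 Thm. (3.11) and (26)–(28); Thm. (1.5)]
[cite: GreenbergLNM1716, §3 (PDF p. 91)] -/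
def lambda_muAnal_multiplicative_of_gvPar : Prop :=
  ∀ (W : WeierstrassCurve ℚ) [W.IsElliptic] [W.IsGloballyMinimal] (p : ℕ) [Fact p.Prime]
    {κ : ZpExtension ℚ p} {γ : Field.absoluteGaloisGroup ℚ} {N : ℕ} [NeZero N]
    {f : CuspForm (Gamma0 N) 2},
    p ≠ 2 → W.HasMultiplicativeReductionAtPrime p → GVPar W p →
    κ.IsCyclotomic → κ.IsTopGenerator γ → IsCyclotomicVariable p γ → IsNewformOf W f →
    ∀ (D : W.SelmerDualData κ γ) (ϖ : ℚ), (ϖ : ℝ) * W.realPeriodRat = plusPeriod f →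
    ∀ (fE : IwasawaAlgebra p), D.charIdeal = Ideal.span {fE} →
      (W.HasSplitMultiplicativeReductionAtPrime p →
        ∀ (L : PowerSeries ℚ_[p]), IsSplitMultPAdicLFunctionOf f p L →
        ∀ (b : IwasawaAlgebra p), iwasawaToPowerSeries p b = PowerSeries.C ((ϖ : ℚ) : ℚ_[p]) * L →
          HasUnitContent b ∧
            (PowerSeries.map (PadicInt.toZMod (p := p)) b).order =
              (PowerSeries.map (PadicInt.toZMod (p := p)) (PowerSeries.X * fE)).order) ∧
      (¬ W.HasSplitMultiplicativeReductionAtPrime p →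
        ∀ (L : PowerSeries ℚ_[p]), IsMultPAdicLFunctionOf f p (-1) L →
        ∀ (b : IwasawaAlgebra p), iwasawaToPowerSeries p b = PowerSeries.C ((ϖ : ℚ) : ℚ_[p]) * L →
          HasUnitContent b ∧
            (PowerSeries.map (PadicInt.toZMod (p := p)) b).order =
              (PowerSeries.map (PadicInt.toZMod (p := p)) fE).order)

/-! ### The monolithic fact from its numbered parts and this one, and conversely -/

/-- (GV) gives a rational line, hence `E[p]` is reducible (the hypothesis of Wuthrich's Thm. 16).
[folklore] -/
private theorem not_irr_of_gvPar' {W : WeierstrassCurve ℚ} [W.IsElliptic] {p : ℕ} [Fact p.Prime]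
    (hpar : GVPar W p) : ¬ W.HasIrreducibleModPGaloisRep p := by
  obtain ⟨Φ, hΦ, -⟩ := hpar
  exact not_hasIrreducibleModPGaloisRep_of_isRationalLine hΦ

/-- **The monolithic Greenberg–Vatsal-at-`p ‖ N` fact from its parts.** Wuthrich 2014 Thm. 16
(multiplicative clauses, `E[p]` reducible: torsion and `ϖ·L = ι(T^e·g)` with `g ∈ char X` —
integrality included) + Greenberg 1999 Prop. 5.10 (torsion, `char X = (fE)` with `μ(fE) = 0`) + the
`λ`/`μ^anal` fact of this file ⇒ `lambdaMu_multiplicative_of_gvPar` (claims (i)–(v)). So the X2a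
closure `Summit.…X2.targetA_of_published` rests on numbered published theorems plus exactly
`lambda_muAnal_multiplicative_of_gvPar`. [cite: Wuthrich2014, Thm. 16 (p. 397)]
[cite: GreenbergLNM1716, Prop. 5.10 (PDF p. 147)] [cite: GreenbergVatsal2000, §2 (16), §3 Thm. (3.11)] -/
theorem lambdaMu_multiplicative_of_gvPar_of_parts
    (hWu : Wuthrich2014.thm16_charIdeal_dvd_multiplicative_of_reducible)
    (hG : Greenberg1999.prop510_isTorsion_hasUnitContent_of_gvPar)
    (hlam : lambda_muAnal_multiplicative_of_gvPar) : lambdaMu_multiplicative_of_gvPar := by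
  intro W _ _ p _ κ γ N _ f hp hmult hpar hκ hγ hγ' hf D ϖ hϖ
  have hred : ¬ W.HasIrreducibleModPGaloisRep p := not_irr_of_gvPar' hpar
  obtain ⟨hX, fE, hchar, hufE⟩ := hG.of_mult W p hp hmult hpar hκ hγ D
  obtain ⟨-, hWns, hWsplit⟩ := hWu W p hp hmult hred hκ hγ hγ' hf D ϖ hϖ
  have hlam' := hlam W p hp hmult hpar hκ hγ hγ' hf D ϖ hϖ fE hchar
  refine ⟨hX, fE, hchar, hufE, ?_, ?_⟩
  · intro hsplit L hL
    obtain ⟨g, -, hιg⟩ := hWsplit hsplit L hL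
    obtain ⟨hub, hord⟩ := hlam'.1 hsplit L hL (PowerSeries.X * g) hιg
    exact ⟨PowerSeries.X * g, hιg, hub, hord⟩
  · intro hns L hL
    obtain ⟨g, -, hιg⟩ := hWns hns L hL
    obtain ⟨hub, hord⟩ := hlam'.2 hns L hL g hιg
    exact ⟨g, hιg, hub, hord⟩

/-- **Conversely**, the monolithic fact projects onto the `λ`/`μ^anal` fact: the element `b` with
`ι b = ϖ·L` is unique (`ι` injective) and the `T`-adic order of the reduction of a generator of
`char X` does not depend on the generator. [cite: GreenbergVatsal2000, p. 20 (arXiv p. 4)] -/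
theorem lambda_muAnal_of_lambdaMu_multiplicative (h : lambdaMu_multiplicative_of_gvPar) :
    lambda_muAnal_multiplicative_of_gvPar := by
  intro W _ _ p _ κ γ N _ f hp hmult hpar hκ hγ hγ' hf D ϖ hϖ fE hchar
  obtain ⟨-, fE', hchar', -, hsp, hnsp⟩ := h W p hp hmult hpar hκ hγ hγ' hf D ϖ hϖ
  -- two generators of the same principal ideal of the domain `Λ` differ by a unit
  have hspan : Ideal.span {fE'} = Ideal.span {fE} := hchar'.symm.trans hchar
  obtain ⟨u, hu⟩ := Ideal.span_singleton_eq_span_singleton.mp hspan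
  -- reductions mod `p`: multiplying by a unit does not change the `T`-adic order
  set red := PowerSeries.map (PadicInt.toZMod (p := p)) with hred_def
  have hured : IsUnit (red (u : IwasawaAlgebra p)) := (Units.isUnit u).map red
  have hord_fE : (red fE).order = (red fE').order := by
    rw [← hu, map_mul, PowerSeries.order_mul, PowerSeries.order_zero_of_unit hured, add_zero]
  have hord_XfE : (red (PowerSeries.X * fE)).order = (red (PowerSeries.X * fE')).order := by
    rw [map_mul, map_mul, PowerSeries.order_mul, PowerSeries.order_mul, hord_fE]
  refine ⟨fun hsplit L hL b hιb => ?_, fun hns L hL b hιb => ?_⟩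
  · obtain ⟨b', hιb', hub', hord'⟩ := hsp hsplit L hL
    have hbb : b = b' := iwasawaToPowerSeries_injective p (hιb.trans hιb'.symm)
    subst hbb
    exact ⟨hub', hord'.trans hord_XfE.symm⟩
  · obtain ⟨b', hιb', hub', hord'⟩ := hnsp hns L hL
    have hbb : b = b' := iwasawaToPowerSeries_injective p (hιb.trans hιb'.symm)
    subst hbb
    exact ⟨hub', hord'.trans hord_fE.symm⟩

/-- **Equivalence**: granted the two NUMBERED published facts (Wuthrich 2014 Thm. 16, Greenberg 1999
Prop. 5.10), the monolithic Greenberg–Vatsal-at-`p ‖ N` fact is equivalent to the `λ`/`μ^anal` fact of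
this file — which is therefore the exact content of the cell's flag `GV00-mult-asserted`.
[cite: GreenbergVatsal2000, §2 (16), §3 Thm. (3.11), p. 20] [cite: Wuthrich2014, Thm. 16 (p. 397)]
[cite: GreenbergLNM1716, Prop. 5.10 (PDF p. 147)] -/
theorem lambdaMu_multiplicative_of_gvPar_iff_parts
    (hWu : Wuthrich2014.thm16_charIdeal_dvd_multiplicative_of_reducible)
    (hG : Greenberg1999.prop510_isTorsion_hasUnitContent_of_gvPar) :
    lambdaMu_multiplicative_of_gvPar ↔ lambda_muAnal_multiplicative_of_gvPar :=
  ⟨lambda_muAnal_of_lambdaMu_multiplicative, lambdaMu_multiplicative_of_gvPar_of_parts hWu hG⟩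

end Literature.NumberTheory.EllipticCurves.GreenbergVatsal2000

end
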